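import Summits.KontsevichZagierPeriods.KontsevichZagierPeriods.Theses.TorsionLogs
import Summits.KontsevichZagierPeriods.KontsevichZagierPeriods.Theorems.TorsionLogsNeronTorsionSector
import Summits.KontsevichZagierPeriods.KontsevichZagierPeriods.Theorems.TorsionLogsNeronTorsionFlexHeightChain
import Literature.NumberTheory.Transcendental.KZKernelConjectureForms
import Literature.NumberTheory.Transcendental.KZMoveFamily
import Summits.KontsevichZagierPeriods.KontsevichZagierPeriods.Theorems.TorsionLogsNeronTorsionFlexTorsionValue
import Summits.KontsevichZagierPeriods.KontsevichZagierPeriods.Theorems.TorsionLogsNeronTorsionFlexRepValues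
import Mathlib.MeasureTheory.Integral.IntervalIntegral.FundThmCalculus
import Mathlib.Analysis.SpecialFunctions.Log.Deriv
/-!
# On-path lemma (F4) for the rung `NeronTorsionArcs` — line `NeronTorsionModularArc` — PROVED
# (crux `TorsionSectorComplete`, stmt-KontsevichZagierPeriods-14212; route `TorsionLogs`; forward generator G1, gen 16)

`theorem neronTorsionArcs_of_kontsevichZagierPeriods (h : KontsevichZagierPeriods) : NeronTorsionArcs`
— SORRY-FREE AND UNCONDITIONAL: the rung is a consequence of the sub-problem statement (on_path = true).

Member `false` is the proved floor (`rung_false`).  Member `true` = Conjecture 1 in kernel form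
(`kzKernelConjecture_iff_isRational`) applied to the pinned element, whose evaluation vanishes by the
**modular-arc value identity** `arcValueIdentity : ArcValueIdentity`, PROVED here:
(1) Fubini on `Fin 3 → ℝ` with the parameter `t = z 2` LAST (`snoc3`, `MeasurableEquiv.piFinSuccAbove _ 2`,
`value_eq_setIntegral_slices`); (2) the fibrewise Néron–torsion identity on RAW integrals at every real
fibre, algebraic or not (`neronTorsion_value_identity_raw` — the body of the landed
`neronTorsion_value_identity` of `Theorems/TorsionLogsNeronTorsionFlexTorsionValue.lean` with the two
`value_*_eq` rewrites removed, plus the non-vanishing of the division value and the positivity of the tangent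
datum); (3) `∫₀¹ (B−1) du/(1+u(B−1)) = log B` for every `B > 0` and Fubini on the box with `t` outer
(`value_logBox_eq`).  No new mathematics beyond the landed fibre identity.
Self-contained: verbatim copies of the `def`s of `Lines/NeronTorsionModularArc.lean` in the namespace
`…NeronTorsionModularArc.OnPath`.
-/

noncomputable section

open Set MeasureTheory
open Literature.NumberTheory.Transcendental
open Summit.KontsevichZagierPeriods.KontsevichZagierPeriods.TorsionLogs.NeronDuplication
open Summit.KontsevichZagierPeriods.KontsevichZagierPeriods.Theses.TorsionLogs
  (NeronTorsionPrimitiveChain TorsionSectorComplete)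

set_option linter.dupNamespace false

namespace Summit.KontsevichZagierPeriods.KontsevichZagierPeriods.Cruxes.TorsionSectorComplete.NeronTorsionModularArc.OnPath

/-! ### Fibre data of the pencil through the 2-torsion abscissa `e₁` -/

/-- The pencil cubic `f_t(x) = 4x³ − t x − (4e₁³ − t e₁) = (x − e₁)(4x² + 4e₁x + 4e₁² − t)`
(`g₂ = t`, `g₃ = 4e₁³ − t e₁`; every real Weierstrass cubic with largest root `e₁` is a fibre). -/
def pencil (e₁ t x : ℝ) : ℝ := 4 * x ^ 3 - t * x - (4 * e₁ ^ 3 - t * e₁)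

/-- Mathlib-normalised model `Y² = X³ − (t/4)X − g₃(t)/4` of the fibre (`y = 2Y`), as in the floor. -/
def fibreCurve (e₁ t : ℝ) : WeierstrassCurve ℝ := ⟨0, 0, 0, -t / 4, -(4 * e₁ ^ 3 - t * e₁) / 4⟩

/-- The fibrewise Néron datum `A_N(t) = |ψ_{N−1}(x_P(t), y_P(t)/2)|` (division value at the torsion
section; along `Y₁(N)` a modular-unit-type function). -/
def neronUnit (e₁ : ℝ) (N : ℕ) (xP : ℝ → ℝ) (t : ℝ) : ℝ :=
  |((fibreCurve e₁ t).ψ ((N : ℤ) - 1)).evalEval (xP t) (Real.sqrt (pencil e₁ t (xP t)) / 2)|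

/-- The fibrewise tangent datum `D(t) = 3e₁² − g₂(t)/4 = f_t′(e₁)/4`. -/
def tangentDatum (e₁ t : ℝ) : ℝ := 3 * e₁ ^ 2 - t / 4

/-- The "log box" integrand `(u, t) ↦ (B(t) − 1)/(1 + u (B(t) − 1))` on `0 < u < 1`: its `u`-integral
is `log B(t)` for every `B(t) > 0`; `ℚ`-semialgebraic in `(u, t)` when `B` is. -/
def logBox (B : ℝ → ℝ) (w : Fin 2 → ℝ) : ℝ := (B (w 1) - 1) / (1 + w 0 * (B (w 1) - 1))

/-- The box `0 < u < 1`, `t₀ < t < t₁` (coordinates `w 0 = u`, `w 1 = t`). -/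
def box (t₀ t₁ : ℝ) : Set (Fin 2 → ℝ) := {w | 0 < w 0 ∧ w 0 < 1 ∧ t₀ < w 1 ∧ w 1 < t₁}

/-! ### The statements -/

/-- Hypotheses on the arc: fixed 2-torsion abscissa `e₁ > 0`, arc `t₀ < t < t₁` of the pencil on
which `Δ ≠ 0` and `e₁` is the largest root, and a real `N`-torsion section `x_P(t) > e₁` on the
identity component (`N ≥ 3`, `0 < a < N/2`, period relation `N·∫_{x_P(t)}^∞ dx/√f_t = a·ω₁(t)`). -/
def ArcData (e₁ t₀ t₁ : ℝ) (N a : ℕ) (xP : ℝ → ℝ) : Prop :=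
  0 < e₁ ∧ t₀ < t₁ ∧ 3 ≤ N ∧ 0 < a ∧ 2 * a < N ∧
  (∀ t ∈ Set.Ioo t₀ t₁, t ^ 3 - 27 * (4 * e₁ ^ 3 - t * e₁) ^ 2 ≠ 0) ∧
  (∀ t ∈ Set.Ioo t₀ t₁, ∀ x, e₁ < x → 0 < pencil e₁ t x) ∧
  (∀ t ∈ Set.Ioo t₀ t₁, e₁ < xP t) ∧
  (∀ t ∈ Set.Ioo t₀ t₁, ∀ hns : (fibreCurve e₁ t).toAffine.Nonsingular (xP t)
      (Real.sqrt (pencil e₁ t (xP t)) / 2),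
    addOrderOf (WeierstrassCurve.Affine.Point.some (xP t) (Real.sqrt (pencil e₁ t (xP t)) / 2) hns) = N) ∧
  (∀ t ∈ Set.Ioo t₀ t₁, (N : ℝ) * (∫ x in Set.Ioi (xP t), (Real.sqrt (pencil e₁ t x))⁻¹) =
    a * (2 * ∫ x in Set.Ioi e₁, (Real.sqrt (pencil e₁ t x))⁻¹))

/-- The two dimension-3 fibred representations over the arc (parameter `t = z 2` LAST):
`R_I = ∫_{t₀}^{t₁} ∫∫_{e₁<x′<x<x_P(t)} x′ dx′ dx dt/(√f_t(x′)√f_t(x))` (fibre = the floor's `rI`) and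
`R_P = ∫_{t₀}^{t₁} ∫∫_{x,x′>e₁} (√f_t(x))⁻¹ (g₂(t)x′+2g₃(t)) dx dx′ dt/(2x′²√f_t(x′))` (fibre = `ω₁η₁/2`). -/
def ArcReps (e₁ t₀ t₁ : ℝ) (xP : ℝ → ℝ) (RI RP : KZ.IntegralRep 3) : Prop :=
  RI.domain = {z | t₀ < z 2 ∧ z 2 < t₁ ∧ e₁ < z 1 ∧ z 1 < z 0 ∧ z 0 < xP (z 2)} ∧
  Set.EqOn RI.integrand
    (fun z => z 1 / (Real.sqrt (pencil e₁ (z 2) (z 1)) * Real.sqrt (pencil e₁ (z 2) (z 0)))) RI.domain ∧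
  RP.domain = {z | t₀ < z 2 ∧ z 2 < t₁ ∧ e₁ < z 0 ∧ e₁ < z 1} ∧
  Set.EqOn RP.integrand
    (fun z => (Real.sqrt (pencil e₁ (z 2) (z 0)))⁻¹ *
      ((z 2 * z 1 + 2 * (4 * e₁ ^ 3 - z 2 * e₁)) / (2 * (z 1) ^ 2 * Real.sqrt (pencil e₁ (z 2) (z 1)))))
    RP.domain

/-- **Member `true` — the Néron–torsion chain along a modular arc (THE NEW STATEMENT, pinned,
value-free).** For arc data as above and the fibred representations `R_I`, `R_P`, and the two log
boxes `R_ψ = ∫∫ logBox A_N`, `R_D = ∫∫ logBox D` over the arc: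
`(N−2)·4N²•[R_I] + (N−2)(N−2a)²•[R_P] − 4N•[R_ψ] + N²(N−2)•[R_D] ∈ KZ.relations`
— the integral over the arc of the fibrewise Néron identity
`(N−2)(4N²·I(P_t) + (N−2a)²·ω₁η₁/2) = 4N·log A_N(t) − N²(N−2)·log D(t)`
(landed fibrewise: `neronTorsion_value_identity`, `neronTorsion_height_chain`). -/
def NeronTorsionArcChain : Prop :=
  ∀ (e₁ t₀ t₁ : ℝ) (N a : ℕ) (xP : ℝ → ℝ), ArcData e₁ t₀ t₁ N a xP →
    ∀ (RI RP : KZ.IntegralRep 3) (Rψ RD : KZ.IntegralRep 2), ArcReps e₁ t₀ t₁ xP RI RP →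
      Rψ.domain = box t₀ t₁ → Set.EqOn Rψ.integrand (logBox (neronUnit e₁ N xP)) Rψ.domain →
      RD.domain = box t₀ t₁ → Set.EqOn RD.integrand (logBox (tangentDatum e₁)) RD.domain →
      (((N : ℤ) - 2) * (4 * (N : ℤ) ^ 2)) • KZ.of RI
        + (((N : ℤ) - 2) * ((N : ℤ) - 2 * (a : ℤ)) ^ 2) • KZ.of RP
        - (4 * (N : ℤ)) • KZ.of Rψ + ((N : ℤ) ^ 2 * ((N : ℤ) - 2)) • KZ.of RD ∈ KZ.relations

/-- **The family, graded by the base dimension `b` (`false` ↦ b = 0: one fibre — the floor decl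
`Theses.TorsionLogs.NeronTorsionPrimitiveChain` VERBATIM; `true` ↦ b = 1: an arc of `Y₁(N)`).** -/
def NeronTorsionArcMember : Bool → Prop
  | false => NeronTorsionPrimitiveChain
  | true => NeronTorsionArcChain

/-- **THE RUNG `NeronTorsionArcs`**: both base dimensions. -/
def NeronTorsionArcs : Prop := ∀ b : Bool, NeronTorsionArcMember b

/-! ### Fubini with the parameter last (dimension 3) -/

/-- `(t, w) ↦ ![w 0, w 1, t]` (parameter LAST). -/
def snoc3 (p : ℝ × (Fin 2 → ℝ)) : Fin 3 → ℝ := ![p.2 0, p.2 1, p.1]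

theorem piFinSuccAbove_two_symm_apply (p : ℝ × (Fin 2 → ℝ)) :
    (MeasurableEquiv.piFinSuccAbove (fun _ : Fin 3 => ℝ) 2).symm p = snoc3 p := by
  ext i
  fin_cases i <;> simp [MeasurableEquiv.piFinSuccAbove, snoc3, Fin.insertNthEquiv] <;> rfl

theorem snoc3_eq_symm :
    (snoc3 : ℝ × (Fin 2 → ℝ) → Fin 3 → ℝ) = ⇑(MeasurableEquiv.piFinSuccAbove (fun _ : Fin 3 => ℝ) 2).symm :=
  funext fun p => (piFinSuccAbove_two_symm_apply p).symm

theorem measurableEmbedding_snoc3 : MeasurableEmbedding snoc3 := by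
  rw [snoc3_eq_symm]
  exact (MeasurableEquiv.piFinSuccAbove (fun _ : Fin 3 => ℝ) 2).symm.measurableEmbedding

theorem measurePreserving_snoc3 :
    MeasurePreserving snoc3 ((volume : Measure ℝ).prod (volume : Measure (Fin 2 → ℝ))) volume := by
  rw [snoc3_eq_symm, ← Measure.volume_eq_prod]
  exact (volume_preserving_piFinSuccAbove (fun _ : Fin 3 => ℝ) 2).symm _

theorem integral_comp_snoc3 (g : (Fin 3 → ℝ) → ℝ) :
    ∫ p : ℝ × (Fin 2 → ℝ), g (snoc3 p) ∂((volume : Measure ℝ).prod (volume : Measure (Fin 2 → ℝ))) =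
      ∫ z, g z :=
  measurePreserving_snoc3.integral_comp measurableEmbedding_snoc3 g

@[simp] theorem snoc3_zero (p : ℝ × (Fin 2 → ℝ)) : snoc3 p 0 = p.2 0 := rfl
@[simp] theorem snoc3_one (p : ℝ × (Fin 2 → ℝ)) : snoc3 p 1 = p.2 1 := rfl
@[simp] theorem snoc3_two (p : ℝ × (Fin 2 → ℝ)) : snoc3 p 2 = p.1 := rfl

/-- **Fubini with the parameter last**: for an integral representation of dimension 3,
`R.value = ∫ t, ∫ w, R.domain.indicator R.integrand ![w 0, w 1, t]`, and the slices are a.e. integrable. -/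
theorem value_eq_integral_integral_snoc3 (R : KZ.IntegralRep 3) :
    R.value = ∫ t : ℝ, ∫ w : Fin 2 → ℝ, R.domain.indicator R.integrand (snoc3 (t, w)) := by
  have hint : Integrable (fun p : ℝ × (Fin 2 → ℝ) => R.domain.indicator R.integrand (snoc3 p))
      ((volume : Measure ℝ).prod (volume : Measure (Fin 2 → ℝ))) :=
    (measurePreserving_snoc3.integrable_comp_emb measurableEmbedding_snoc3).mpr
      ((integrable_indicator_iff (KZ.IntegralRep.measurableSet_domain_holds R)).mpr R.integrableOn)
  rw [KZ.IntegralRep.value, ← integral_indicator (KZ.IntegralRep.measurableSet_domain_holds R),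
    ← integral_comp_snoc3, integral_prod _ hint]

theorem integrable_snoc3 (R : KZ.IntegralRep 3) :
    Integrable (fun p : ℝ × (Fin 2 → ℝ) => R.domain.indicator R.integrand (snoc3 p))
      ((volume : Measure ℝ).prod (volume : Measure (Fin 2 → ℝ))) :=
  (measurePreserving_snoc3.integrable_comp_emb measurableEmbedding_snoc3).mpr
    ((integrable_indicator_iff (KZ.IntegralRep.measurableSet_domain_holds R)).mpr R.integrableOn)

theorem ae_integrable_slice_snoc3 (R : KZ.IntegralRep 3) :
    ∀ᵐ t : ℝ, Integrable (fun w : Fin 2 → ℝ => R.domain.indicator R.integrand (snoc3 (t, w))) :=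
  (integrable_snoc3 R).prod_right_ae

theorem integrable_integral_slice_snoc3 (R : KZ.IntegralRep 3) :
    Integrable (fun t : ℝ => ∫ w : Fin 2 → ℝ, R.domain.indicator R.integrand (snoc3 (t, w))) :=
  (integrable_snoc3 R).integral_prod_left


/-- **Slices of a dimension-3 representation over the LAST coordinate**: if the domain is fibred
over the arc `t₀ < t < t₁` with fibres `T t` and the integrand restricts to `G t` on the fibre, then
`R.value = ∫_{t₀}^{t₁} (∫_{T t} G t) dt`, the fibre integrals are integrable in `t`, and almost every
fibre integrand is absolutely integrable. -/
theorem value_eq_setIntegral_slices (R : KZ.IntegralRep 3) (t₀ t₁ : ℝ) (T : ℝ → Set (Fin 2 → ℝ))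
    (G : ℝ → (Fin 2 → ℝ) → ℝ)
    (hdom : ∀ t w, snoc3 (t, w) ∈ R.domain ↔ t ∈ Ioo t₀ t₁ ∧ w ∈ T t)
    (hint : ∀ t ∈ Ioo t₀ t₁, ∀ w ∈ T t, R.integrand (snoc3 (t, w)) = G t w)
    (hTm : ∀ t, MeasurableSet (T t)) :
    R.value = ∫ t in Ioo t₀ t₁, ∫ w in T t, G t w ∧
    IntegrableOn (fun t => ∫ w in T t, G t w) (Ioo t₀ t₁) ∧
    ∀ᵐ t : ℝ, t ∈ Ioo t₀ t₁ → IntegrableOn (G t) (T t) := by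
  -- pointwise description of the transported integrand
  have hpt : ∀ t w, R.domain.indicator R.integrand (snoc3 (t, w)) =
      (Ioo t₀ t₁).indicator (fun t => (T t).indicator (G t) w) t := by
    intro t w
    by_cases ht : t ∈ Ioo t₀ t₁
    · rw [indicator_of_mem ht]
      by_cases hw : w ∈ T t
      · rw [indicator_of_mem ((hdom t w).mpr ⟨ht, hw⟩), indicator_of_mem hw, hint t ht w hw]
      · have hn : snoc3 (t, w) ∉ R.domain := fun h => hw ((hdom t w).mp h).2
        rw [indicator_of_notMem hn, indicator_of_notMem hw]
    · have hn : snoc3 (t, w) ∉ R.domain := fun h => ht ((hdom t w).mp h).1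
      rw [indicator_of_notMem hn, indicator_of_notMem ht]
  have hinner : ∀ t, ∫ w, R.domain.indicator R.integrand (snoc3 (t, w)) =
      (Ioo t₀ t₁).indicator (fun t => ∫ w in T t, G t w) t := by
    intro t
    simp_rw [hpt t]
    by_cases ht : t ∈ Ioo t₀ t₁
    · simp_rw [indicator_of_mem ht]
      exact integral_indicator (hTm t)
    · simp_rw [indicator_of_notMem ht]
      exact integral_zero _ _
  have hfun : (fun t => ∫ w, R.domain.indicator R.integrand (snoc3 (t, w))) =
      (Ioo t₀ t₁).indicator (fun t => ∫ w in T t, G t w) := funext hinner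
  refine ⟨?_, ?_, ?_⟩
  · rw [value_eq_integral_integral_snoc3, hfun, integral_indicator measurableSet_Ioo]
  · have h := integrable_integral_slice_snoc3 R
    rw [hfun] at h
    exact (integrable_indicator_iff measurableSet_Ioo).mp h
  · filter_upwards [ae_integrable_slice_snoc3 R] with t h ht
    have hfun' : (fun w => R.domain.indicator R.integrand (snoc3 (t, w))) = (T t).indicator (G t) := by
      funext w; rw [hpt t w, indicator_of_mem ht]
    rw [hfun'] at h
    exact (integrable_indicator_iff (hTm t)).mp h

/-! ### Dimension-2 raw integrals, boxes and log boxes -/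

/-- `∫₀¹ (b − 1) du/(1 + u (b − 1)) = log b` for `b > 0`. [folklore] -/
theorem integral_logBox_fibre {b : ℝ} (hb : 0 < b) :
    ∫ u in Ioo (0 : ℝ) 1, (b - 1) / (1 + u * (b - 1)) = Real.log b := by
  rw [← integral_Ioc_eq_integral_Ioo, ← intervalIntegral.integral_of_le zero_le_one]
  have hpos : ∀ θ ∈ uIcc (0 : ℝ) 1, 0 < 1 + θ * (b - 1) := fun θ hθ => by
    rw [uIcc_of_le zero_le_one] at hθ
    nlinarith [hθ.1, hθ.2, mul_nonneg hθ.1 hb.le]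
  have hderiv : ∀ θ ∈ uIcc (0 : ℝ) 1,
      HasDerivAt (fun θ => Real.log (1 + θ * (b - 1))) ((b - 1) / (1 + θ * (b - 1))) θ := by
    intro θ hθ
    have h1 : HasDerivAt (fun θ : ℝ => 1 + θ * (b - 1)) (b - 1) θ := by
      simpa using ((hasDerivAt_id θ).mul_const (b - 1)).const_add 1
    convert h1.log (hpos θ hθ).ne' using 1
  have hcont : ContinuousOn (fun θ : ℝ => (b - 1) / (1 + θ * (b - 1))) (Icc 0 1) :=
    continuousOn_const.div (by fun_prop) fun θ hθ => (hpos θ (by rwa [uIcc_of_le zero_le_one])).ne'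
  rw [intervalIntegral.integral_eq_sub_of_hasDerivAt hderiv
    (hcont.intervalIntegrable_of_Icc zero_le_one)]
  simp


/-- Raw triangle integral (the computation of `value_triangle_eq` for a bare set integral with an
integrability hypothesis). -/
theorem setIntegral_triangle_raw (x e₁ : ℝ) (f : ℝ → ℝ)
    (hG0 : IntegrableOn (fun z : Fin 2 → ℝ => z 1 / (Real.sqrt (f (z 1)) * Real.sqrt (f (z 0))))
      {z | e₁ < z 1 ∧ z 1 < z 0 ∧ z 0 < x}) :
    ∫ z in {z : Fin 2 → ℝ | e₁ < z 1 ∧ z 1 < z 0 ∧ z 0 < x},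
        z 1 / (Real.sqrt (f (z 1)) * Real.sqrt (f (z 0))) =
      ∫ a in Ioo e₁ x, (∫ b in Ioo e₁ a, b / Real.sqrt (f b)) * (Real.sqrt (f a))⁻¹ := by
  set G : ℝ × ℝ → ℝ := fun p => p.2 / (Real.sqrt (f p.2) * Real.sqrt (f p.1)) with hG
  set T : Set (ℝ × ℝ) := {p | e₁ < p.2 ∧ p.2 < p.1 ∧ p.1 < x} with hT
  have hTm : MeasurableSet T := by
    simp only [hT, setOf_and]
    refine (measurableSet_lt measurable_const measurable_snd).inter
      ((measurableSet_lt measurable_snd measurable_fst).inter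
        (measurableSet_lt measurable_fst measurable_const))
  have hset : (fun p : ℝ × ℝ => (![p.1, p.2] : Fin 2 → ℝ)) ⁻¹'
      {z : Fin 2 → ℝ | e₁ < z 1 ∧ z 1 < z 0 ∧ z 0 < x} = T := by
    ext p
    simp [hT]
  have hGint : IntegrableOn G T (volume.prod volume) := by
    have h := integrableOn_prod_of_fin_two hG0
    rw [hset] at h
    refine h.congr_fun (fun p _ => ?_) hTm
    simp [hG]
  rw [setIntegral_fin_two_eq_prod, hset]
  simp only [Matrix.cons_val_zero, Matrix.cons_val_one]
  change ∫ p in T, G p ∂(volume.prod volume) = _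
  have hTsub : T ⊆ Ioo e₁ x ×ˢ Ioo e₁ x := by
    intro p hp
    exact ⟨⟨lt_trans hp.1 hp.2.1, hp.2.2⟩, ⟨hp.1, hp.2.1.trans hp.2.2⟩⟩
  have h1 : ∫ p in T, G p ∂(volume.prod volume) =
      ∫ p in Ioo e₁ x ×ˢ Ioo e₁ x, T.indicator G p ∂(volume.prod volume) := by
    rw [setIntegral_indicator hTm, inter_eq_self_of_subset_right hTsub]
  have hind : IntegrableOn (T.indicator G) (Ioo e₁ x ×ˢ Ioo e₁ x) (volume.prod volume) :=
    (integrable_indicator_iff hTm |>.mpr hGint).integrableOn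
  rw [h1, setIntegral_prod _ hind]
  refine setIntegral_congr_fun measurableSet_Ioo fun a ha => ?_
  have hfib : ∀ b, T.indicator G (a, b) = (Ioo e₁ a).indicator
      (fun b => b / Real.sqrt (f b) * (Real.sqrt (f a))⁻¹) b := by
    intro b
    by_cases hb : b ∈ Ioo e₁ a
    · have hab : (a, b) ∈ T := ⟨hb.1, hb.2, ha.2⟩
      rw [indicator_of_mem hab, indicator_of_mem hb, hG]
      simp only
      rw [div_mul_eq_div_div, div_eq_mul_inv (b / Real.sqrt (f b))]
    · have hab : (a, b) ∉ T := fun h => hb ⟨h.1, h.2.1⟩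
      rw [indicator_of_notMem hab, indicator_of_notMem hb]
  simp_rw [hfib]
  rw [setIntegral_indicator measurableSet_Ioo,
    show Ioo e₁ x ∩ Ioo e₁ a = Ioo e₁ a from
      inter_eq_self_of_subset_right (Ioo_subset_Ioo le_rfl ha.2.le),
    integral_mul_const]

/-- Raw quadrant integral with product integrand. -/
theorem setIntegral_quadrant_raw (e₁ : ℝ) (φ ψ : ℝ → ℝ) :
    ∫ z in {z : Fin 2 → ℝ | e₁ < z 0 ∧ e₁ < z 1}, φ (z 0) * ψ (z 1) =
      (∫ a in Ioi e₁, φ a) * (∫ b in Ioi e₁, ψ b) := by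
  rw [setIntegral_fin_two_eq_prod]
  have hset : (fun p : ℝ × ℝ => (![p.1, p.2] : Fin 2 → ℝ)) ⁻¹'
      {z : Fin 2 → ℝ | e₁ < z 0 ∧ e₁ < z 1} = Ioi e₁ ×ˢ Ioi e₁ := by
    ext p
    simp [mem_prod]
  rw [hset]
  simp only [Matrix.cons_val_zero, Matrix.cons_val_one]
  exact setIntegral_prod_mul φ ψ (Ioi e₁) (Ioi e₁)

/-- **Fubini on the box with the parameter `t = w 1` OUTER**, with integrability of the fibre
integrals. -/
theorem setIntegral_box_eq (t₀ t₁ : ℝ) (G : (Fin 2 → ℝ) → ℝ) (hG : IntegrableOn G (box t₀ t₁)) :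
    ∫ w in box t₀ t₁, G w = ∫ t in Ioo t₀ t₁, ∫ u in Ioo 0 1, G ![u, t] ∧
    IntegrableOn (fun t => ∫ u in Ioo 0 1, G ![u, t]) (Ioo t₀ t₁) := by
  have hset : (fun p : ℝ × ℝ => (![p.1, p.2] : Fin 2 → ℝ)) ⁻¹' box t₀ t₁ = Ioo 0 1 ×ˢ Ioo t₀ t₁ := by
    ext p
    simp only [box, mem_preimage, mem_setOf_eq, Matrix.cons_val_zero, Matrix.cons_val_one, mem_prod,
      mem_Ioo]
    tauto
  have hint : IntegrableOn (fun p : ℝ × ℝ => G ![p.1, p.2]) (Ioo 0 1 ×ˢ Ioo t₀ t₁) (volume.prod volume) := by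
    have h := integrableOn_prod_of_fin_two hG
    rwa [hset] at h
  have hint' : Integrable (fun z : ℝ × ℝ => G ![z.2, z.1])
      ((volume.restrict (Ioo t₀ t₁)).prod (volume.restrict (Ioo 0 1))) := by
    rw [IntegrableOn, ← Measure.prod_restrict] at hint
    exact hint.swap
  refine ⟨?_, ?_⟩
  · rw [setIntegral_fin_two_eq_prod, hset, ← setIntegral_prod_swap]
    simp only [Prod.swap_prod_mk, Prod.fst_swap, Prod.snd_swap]
    have hint'' : IntegrableOn (fun z : ℝ × ℝ => G ![z.2, z.1]) (Ioo t₀ t₁ ×ˢ Ioo 0 1)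
        (volume.prod volume) := by
      rw [IntegrableOn, ← Measure.prod_restrict]; exact hint'
    rw [setIntegral_prod _ hint'']
  · exact hint'.integral_prod_left

/-- **Value of a log box**: if `R.domain = box t₀ t₁`, `R.integrand = logBox B` on it and `B > 0` on
the arc, then `R.value = ∫_{t₀}^{t₁} log B(t) dt`, and `log B` is integrable on the arc. -/
theorem value_logBox_eq (R : KZ.IntegralRep 2) (t₀ t₁ : ℝ) (B : ℝ → ℝ) (hdom : R.domain = box t₀ t₁)
    (hint : Set.EqOn R.integrand (logBox B) R.domain) (hB : ∀ t ∈ Ioo t₀ t₁, 0 < B t) :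
    R.value = ∫ t in Ioo t₀ t₁, Real.log (B t) ∧
    IntegrableOn (fun t => Real.log (B t)) (Ioo t₀ t₁) := by
  have hG : IntegrableOn (logBox B) (box t₀ t₁) := by
    rw [← hdom]
    exact R.integrableOn.congr_fun hint (KZ.IntegralRep.measurableSet_domain_holds R)
  obtain ⟨hval, hintg⟩ := setIntegral_box_eq t₀ t₁ (logBox B) hG
  have hfib : ∀ t ∈ Ioo t₀ t₁, ∫ u in Ioo 0 1, logBox B ![u, t] = Real.log (B t) := by
    intro t ht
    simp only [logBox, Matrix.cons_val_zero, Matrix.cons_val_one]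
    exact integral_logBox_fibre (hB t ht)
  refine ⟨?_, hintg.congr_fun hfib measurableSet_Ioo⟩
  rw [KZ.IntegralRep.value, setIntegral_congr_fun (KZ.IntegralRep.measurableSet_domain_holds R) hint,
    hdom, hval]
  exact setIntegral_congr_fun measurableSet_Ioo hfib


/-! ### The fibrewise Néron–torsion identity on raw integrals -/

section Fibre

open Filter Topology Complex Polynomial
open scoped PeriodPair Polynomial.Bivariate
open Summit.KontsevichZagierPeriods.KontsevichZagierPeriods.Cruxes.NeronTorsionSector.Translation
  (weierstrassPRe_half_eq integral_Ioi_weierstrassPRe_eq)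
open Summit.KontsevichZagierPeriods.KontsevichZagierPeriods.TorsionLogs.NeronHeight

variable {L : PeriodPair}

/-- `|ψₙ(X t, X′ t/2)| ≠ 0` for a real point with a rational period `(n+1)t = bΩ₀`
(the division formula `‖σ(nt)‖ = |ψₙ|‖σ t‖^{n²}` with `nt = bΩ₀ − t ∉ Λ`). [folklore] -/
theorem abs_evalEval_ψ_ne_zero_of_period (hR : L.IsReal) {t : ℝ} (ht : t ∈ Ioo 0 L.minRealPeriod)
    (n b : ℕ) (hb : ((n : ℝ) + 1) * t = b * L.minRealPeriod) :
    |((⟨0, 0, 0, -L.g₂.re / 4, -L.g₃.re / 4⟩ : WeierstrassCurve ℝ).ψ n).evalEval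
        (L.weierstrassPRe t) (L.derivWeierstrassPRe t / 2)| ≠ 0 := by
  have ht' : (t : ℂ) ∉ L.lattice := hR.ofReal_notMem_lattice ht.1 ht.2
  have hσt : ‖L.weierstrassSigma t‖ ≠ 0 := norm_ne_zero_iff.mpr (L.weierstrassSigma_ne_zero ht')
  have h1 := norm_weierstrassSigma_nat_mul_real hR n t
  rw [show ((n * t : ℝ) : ℂ) = ((b * L.minRealPeriod - t : ℝ) : ℂ) by
      rw [show (n : ℝ) * t = b * L.minRealPeriod - t by linarith [hb]],
    norm_weierstrassSigma_nat_mul_sub hR b t] at h1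
  intro h0
  rw [h0, zero_mul] at h1
  exact mul_ne_zero (Real.exp_pos _).ne' hσt h1

/-- **The Néron–torsion value identity on RAW integrals** (no integral representations): the body of
`neronTorsion_value_identity` after its two `value_*_eq` rewrites, with the unused torsion-order
hypotheses dropped. Valid at every real fibre, algebraic or not. -/
theorem neronTorsion_value_identity_raw :
    ∀ (g₂ g₃ e₁ xP yP : ℝ) (N a : ℕ) (f : ℝ → ℝ), (∀ x, f x = 4 * x ^ 3 - g₂ * x - g₃) →
    g₂ ^ 3 - 27 * g₃ ^ 2 ≠ 0 → f e₁ = 0 → 0 < e₁ → (∀ x, e₁ < x → 0 < f x) → e₁ < xP →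
    yP ^ 2 = f xP → 3 ≤ N →
    (N : ℝ) * (∫ x in Set.Ioi xP, (Real.sqrt (f x))⁻¹) =
      a * (2 * ∫ x in Set.Ioi e₁, (Real.sqrt (f x))⁻¹) →
      0 < 3 * e₁ ^ 2 - g₂ / 4 ∧
      0 < |((⟨0, 0, 0, -g₂ / 4, -g₃ / 4⟩ : WeierstrassCurve ℝ).ψ ((N : ℤ) - 1)).evalEval xP (yP / 2)| ∧
      ((N : ℝ) - 2) * (4 * (N : ℝ) ^ 2 *
          (∫ x in Ioo e₁ xP, (∫ y in Ioo e₁ x, y / Real.sqrt (f y)) * (Real.sqrt (f x))⁻¹) +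
        ((N : ℝ) - 2 * a) ^ 2 *
          ((∫ x in Ioi e₁, (Real.sqrt (f x))⁻¹) *
            (∫ x in Ioi e₁, (g₂ * x + 2 * g₃) / (2 * x ^ 2 * Real.sqrt (f x))))) =
        4 * (N : ℝ) * Real.log
            |((⟨0, 0, 0, -g₂ / 4, -g₃ / 4⟩ : WeierstrassCurve ℝ).ψ ((N : ℤ) - 1)).evalEval xP (yP / 2)|
          - (N : ℝ) ^ 2 * ((N : ℝ) - 2) * Real.log (3 * e₁ ^ 2 - g₂ / 4) := by
  intro g₂ g₃ e₁ xP yP N a f hf hΔ hfe he₁ hpos hxP hyP hN hper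
  -- the real lattice with invariants `g₂, g₃`
  obtain ⟨L, hL2, hL3⟩ :=
    PeriodPair.uniformization_holds (g₂ : ℂ) (g₃ : ℂ) (by exact_mod_cast hΔ)
  have hR : L.IsReal := PeriodPair.isReal_of_g₂_g₃_real PeriodPair.uniformization_unique_holds
    (by rw [hL2]; exact Complex.ofReal_im g₂) (by rw [hL3]; exact Complex.ofReal_im g₃)
  have hg2 : L.g₂.re = g₂ := by rw [hL2, Complex.ofReal_re]
  have hg3 : L.g₃.re = g₃ := by rw [hL3, Complex.ofReal_re]
  have hfun : f = fun x => 4 * x ^ 3 - g₂ * x - g₃ := funext hf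
  subst hfun hg2 hg3
  simp only at hfe hpos hyP hper ⊢
  set T := L.minRealPeriod / 2 with hT
  have hΩ := hR.minRealPeriod_pos
  have hT0 : 0 < T := by positivity
  have hXT : L.weierstrassPRe T = e₁ := weierstrassPRe_half_eq hR hfe hpos
  -- the parameter `u = u_P ∈ (0, T)` of `P`
  have hxP' : xP ∈ Ioi (L.weierstrassPRe (L.minRealPeriod / 2)) := by rw [← hT, hXT]; exact hxP
  rw [← hR.image_weierstrassPRe_Ioo] at hxP'
  obtain ⟨u, hu, hXu⟩ := hxP'
  have hu' : u ∈ Ioo 0 L.minRealPeriod := ⟨hu.1, by linarith [hu.2]⟩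
  have hun : (u : ℂ) ∉ L.lattice := hR.ofReal_notMem_lattice hu'.1 hu'.2
  have hY2 : L.derivWeierstrassPRe u ^ 2 = 4 * xP ^ 3 - L.g₂.re * xP - L.g₃.re := by
    rw [← hXu]; exact hR.derivWeierstrassPRe_sq hun
  -- the two raw values
  have hI : (∫ x in Ioo e₁ xP, (∫ y in Ioo e₁ x, y / Real.sqrt (4 * y ^ 3 - L.g₂.re * y - L.g₃.re)) *
        (Real.sqrt (4 * x ^ 3 - L.g₂.re * x - L.g₃.re))⁻¹) =
      Real.log ‖L.weierstrassSigma ((L.minRealPeriod / 2 : ℝ) : ℂ)‖ -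
      Real.log ‖L.weierstrassSigma u‖ -
      (L.weierstrassZeta ((L.minRealPeriod / 2 : ℝ) : ℂ)).re * (L.minRealPeriod / 2 - u) := by
    rw [← iterated_integral_weierstrassPRe hR (by rw [← hT]; exact hu), ← hT, hXT, hXu]
  have hE : ∫ x in Ioi e₁, (L.g₂.re * x + 2 * L.g₃.re) /
      (2 * x ^ 2 * Real.sqrt (4 * x ^ 3 - L.g₂.re * x - L.g₃.re)) =
      2 * (L.weierstrassZeta ((L.minRealPeriod / 2 : ℝ) : ℂ)).re := by
    rw [← integral_quasiPeriodDensity_eq hR (by rw [← hT, hXT]; exact he₁), ← hT, hXT]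
  have hω1 : ∫ x in Ioi xP, (Real.sqrt (4 * x ^ 3 - L.g₂.re * x - L.g₃.re))⁻¹ = u := by
    rw [← hXu]; exact integral_Ioi_weierstrassPRe_eq hR ⟨hu.1, hu.2.le⟩
  have hω2 : ∫ x in Ioi e₁, (Real.sqrt (4 * x ^ 3 - L.g₂.re * x - L.g₃.re))⁻¹ = T := by
    rw [← hXT, hT]; exact hR.integral_Ioi_inv_sqrt_cubic_eq
  -- the period relation `N u = a Ω₀`
  rw [hω1, hω2] at hper
  rw [hω2, hE]
  -- the constant at the 2-torsion point and the real quasi-period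
  obtain ⟨hDpos, hconst⟩ := four_mul_log_norm_weierstrassSigma_half hR
  rw [← hT, hXT] at hDpos hconst
  have hηre : (L.quasiPeriodMap L.minRealPeriod).re =
      2 * (L.weierstrassZeta ((L.minRealPeriod / 2 : ℝ) : ℂ)).re := by
    rw [quasiPeriodMap_minRealPeriod hR]
    simp [Complex.mul_re]
  rw [hηre] at hconst
  -- the division value at `u`
  have hN1 : ((N - 1 : ℕ) : ℝ) = (N : ℝ) - 1 := by
    rw [Nat.cast_sub (by omega), Nat.cast_one]
  have hb : (((N - 1 : ℕ) : ℝ) + 1) * u = a * L.minRealPeriod := by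
    rw [hN1, hT] at *; linarith [hper]
  have hcore := log_abs_evalEval_ψ_of_period hR hu' (N - 1) a hb
  have hidx : ((N - 1 : ℕ) : ℤ) = (N : ℤ) - 1 := by omega
  -- the sign of `y_P` is immaterial
  have hsq : yP ^ 2 = L.derivWeierstrassPRe u ^ 2 := by rw [hY2]; exact hyP
  have hcore' : Real.log |((⟨0, 0, 0, -L.g₂.re / 4, -L.g₃.re / 4⟩ : WeierstrassCurve ℝ).ψ
        ((N : ℤ) - 1)).evalEval xP (yP / 2)| =
      a * (L.quasiPeriodMap L.minRealPeriod).re * (a * (L.minRealPeriod / 2) - u) -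
        (((N - 1 : ℕ) : ℝ) ^ 2 - 1) * Real.log ‖L.weierstrassSigma u‖ := by
    rcases sq_eq_sq_iff_eq_or_eq_neg.1 hsq with hy | hy
    · rw [← hcore, hXu, hidx, hy]
    · rw [← hcore, ← abs_evalEval_ψ_neg hR hu' (N - 1), hXu, hidx, hy]
  rw [hηre, hN1] at hcore'
  -- non-vanishing of the division value
  have hψpos : 0 < |((⟨0, 0, 0, -L.g₂.re / 4, -L.g₃.re / 4⟩ : WeierstrassCurve ℝ).ψ
        ((N : ℤ) - 1)).evalEval xP (yP / 2)| := by
    have h0 := abs_evalEval_ψ_ne_zero_of_period hR hu' (N - 1) a hb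
    refine lt_of_le_of_ne (abs_nonneg _) (Ne.symm ?_)
    rcases sq_eq_sq_iff_eq_or_eq_neg.1 hsq with hy | hy
    · rw [hXu, hidx, ← hy] at h0; exact h0
    · rw [← abs_evalEval_ψ_neg hR hu' (N - 1), hXu, hidx, ← hy] at h0; exact h0
  refine ⟨hDpos, hψpos, ?_⟩
  rw [hI, hcore']
  rw [hT] at *
  linear_combination ((N : ℝ) ^ 2 * ((N : ℝ) - 2)) * hconst +
    (4 * (L.weierstrassZeta ((L.minRealPeriod / 2 : ℝ) : ℂ)).re * ((N : ℝ) * ((N : ℝ) - 2) + 2 * a)) * hper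


end Fibre

/-! ### The modular-arc value identity -/

/-- **The modular-arc value identity**
`(N−2)(4N²·R_I.value + (N−2a)²·R_P.value) = 4N·R_ψ.value − N²(N−2)·R_D.value`. -/
def ArcValueIdentity : Prop :=
  ∀ (e₁ t₀ t₁ : ℝ) (N a : ℕ) (xP : ℝ → ℝ), ArcData e₁ t₀ t₁ N a xP →
    ∀ (RI RP : KZ.IntegralRep 3) (Rψ RD : KZ.IntegralRep 2), ArcReps e₁ t₀ t₁ xP RI RP →
      Rψ.domain = box t₀ t₁ → Set.EqOn Rψ.integrand (logBox (neronUnit e₁ N xP)) Rψ.domain →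
      RD.domain = box t₀ t₁ → Set.EqOn RD.integrand (logBox (tangentDatum e₁)) RD.domain →
      ((N : ℝ) - 2) * (4 * (N : ℝ) ^ 2 * RI.value + ((N : ℝ) - 2 * a) ^ 2 * RP.value) =
        4 * (N : ℝ) * Rψ.value - (N : ℝ) ^ 2 * ((N : ℝ) - 2) * RD.value

/-- **THE MODULAR-ARC VALUE IDENTITY HOLDS** (Fubini over the arc with the parameter last, the
fibrewise Néron–torsion identity on raw integrals at every — possibly transcendental — fibre, and
`∫₀¹ logBox B = log B`). -/
theorem arcValueIdentity : ArcValueIdentity := by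
  intro e₁ t₀ t₁ N a xP hdata RI RP Rψ RD hreps hψdom hψint hDdom hDint
  obtain ⟨he₁, _ht01, hN, _ha, _haN, hΔ, hpos, hxP, _htor, hper⟩ := hdata
  obtain ⟨hIdom, hIint, hPdom, hPint⟩ := hreps
  -- the raw fibre quantities
  set Iraw : ℝ → ℝ := fun t => ∫ x in Ioo e₁ (xP t), (∫ y in Ioo e₁ x,
    y / Real.sqrt (pencil e₁ t y)) * (Real.sqrt (pencil e₁ t x))⁻¹ with hIraw
  set Vraw : ℝ → ℝ := fun t => (∫ x in Ioi e₁, (Real.sqrt (pencil e₁ t x))⁻¹) *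
    (∫ x in Ioi e₁, (t * x + 2 * (4 * e₁ ^ 3 - t * e₁)) /
      (2 * x ^ 2 * Real.sqrt (pencil e₁ t x))) with hVraw
  -- (1) the fibre identity and the positivity of the carriers, at every fibre of the arc
  have hfib : ∀ t ∈ Ioo t₀ t₁, 0 < tangentDatum e₁ t ∧ 0 < neronUnit e₁ N xP t ∧
      ((N : ℝ) - 2) * (4 * (N : ℝ) ^ 2 * Iraw t + ((N : ℝ) - 2 * a) ^ 2 * Vraw t) =
        4 * (N : ℝ) * Real.log (neronUnit e₁ N xP t) -
          (N : ℝ) ^ 2 * ((N : ℝ) - 2) * Real.log (tangentDatum e₁ t) := by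
    intro t ht
    have h := neronTorsion_value_identity_raw t (4 * e₁ ^ 3 - t * e₁) e₁ (xP t)
      (Real.sqrt (pencil e₁ t (xP t))) N a (pencil e₁ t) (fun x => rfl) (hΔ t ht)
      (by simp only [pencil]; ring) he₁ (hpos t ht) (hxP t ht)
      (Real.sq_sqrt (hpos t ht _ (hxP t ht)).le) hN (hper t ht)
    exact h
  -- (2) `R_I.value = ∫ Iraw`
  have hTm : ∀ t, MeasurableSet {w : Fin 2 → ℝ | e₁ < w 1 ∧ w 1 < w 0 ∧ w 0 < xP t} := by
    intro t
    simp only [setOf_and]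
    exact (measurableSet_lt measurable_const (measurable_pi_apply 1)).inter
      ((measurableSet_lt (measurable_pi_apply 1) (measurable_pi_apply 0)).inter
        (measurableSet_lt (measurable_pi_apply 0) measurable_const))
  obtain ⟨hIval, hIintg, hIae⟩ := value_eq_setIntegral_slices RI t₀ t₁
    (fun t => {w | e₁ < w 1 ∧ w 1 < w 0 ∧ w 0 < xP t})
    (fun t w => w 1 / (Real.sqrt (pencil e₁ t (w 1)) * Real.sqrt (pencil e₁ t (w 0))))
    (by
      intro t w
      simp only [hIdom, mem_setOf_eq, snoc3_zero, snoc3_one, snoc3_two, mem_Ioo]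
      tauto)
    (by
      intro t ht w hw
      have hmem : snoc3 (t, w) ∈ RI.domain := by
        rw [hIdom]; exact ⟨ht.1, ht.2, hw.1, hw.2.1, hw.2.2⟩
      rw [hIint hmem]
      simp only [snoc3_zero, snoc3_one, snoc3_two])
    hTm
  have hIae' : ∀ᵐ t : ℝ, t ∈ Ioo t₀ t₁ →
      (∫ w in {w : Fin 2 → ℝ | e₁ < w 1 ∧ w 1 < w 0 ∧ w 0 < xP t},
        w 1 / (Real.sqrt (pencil e₁ t (w 1)) * Real.sqrt (pencil e₁ t (w 0)))) = Iraw t := by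
    filter_upwards [hIae] with t h ht
    exact setIntegral_triangle_raw (xP t) e₁ (pencil e₁ t) (h ht)
  have hIval' : RI.value = ∫ t in Ioo t₀ t₁, Iraw t := by
    rw [hIval]; exact setIntegral_congr_ae measurableSet_Ioo hIae'
  have hIint' : IntegrableOn Iraw (Ioo t₀ t₁) :=
    hIintg.congr_fun_ae ((ae_restrict_iff' measurableSet_Ioo).mpr hIae')
  -- (3) `R_P.value = ∫ Vraw`
  have hQm : MeasurableSet {w : Fin 2 → ℝ | e₁ < w 0 ∧ e₁ < w 1} := by
    simp only [setOf_and]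
    exact (measurableSet_lt measurable_const (measurable_pi_apply 0)).inter
      (measurableSet_lt measurable_const (measurable_pi_apply 1))
  obtain ⟨hPval, hPintg, -⟩ := value_eq_setIntegral_slices RP t₀ t₁
    (fun _ => {w | e₁ < w 0 ∧ e₁ < w 1})
    (fun t w => (Real.sqrt (pencil e₁ t (w 0)))⁻¹ *
      ((t * w 1 + 2 * (4 * e₁ ^ 3 - t * e₁)) / (2 * (w 1) ^ 2 * Real.sqrt (pencil e₁ t (w 1)))))
    (by
      intro t w
      simp only [hPdom, mem_setOf_eq, snoc3_zero, snoc3_one, snoc3_two, mem_Ioo]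
      tauto)
    (by
      intro t ht w hw
      have hmem : snoc3 (t, w) ∈ RP.domain := by
        rw [hPdom]; exact ⟨ht.1, ht.2, hw.1, hw.2⟩
      rw [hPint hmem]
      simp only [snoc3_zero, snoc3_one, snoc3_two])
    (fun _ => hQm)
  have hPfib : ∀ t ∈ Ioo t₀ t₁,
      (∫ w in {w : Fin 2 → ℝ | e₁ < w 0 ∧ e₁ < w 1}, (Real.sqrt (pencil e₁ t (w 0)))⁻¹ *
        ((t * w 1 + 2 * (4 * e₁ ^ 3 - t * e₁)) / (2 * (w 1) ^ 2 * Real.sqrt (pencil e₁ t (w 1))))) =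
        Vraw t := by
    intro t _
    exact setIntegral_quadrant_raw e₁ (fun x => (Real.sqrt (pencil e₁ t x))⁻¹)
      (fun x => (t * x + 2 * (4 * e₁ ^ 3 - t * e₁)) / (2 * x ^ 2 * Real.sqrt (pencil e₁ t x)))
  have hPval' : RP.value = ∫ t in Ioo t₀ t₁, Vraw t := by
    rw [hPval]; exact setIntegral_congr_fun measurableSet_Ioo hPfib
  have hPint' : IntegrableOn Vraw (Ioo t₀ t₁) := hPintg.congr_fun hPfib measurableSet_Ioo
  -- (4) the two log boxes
  obtain ⟨hψval, hψintg⟩ := value_logBox_eq Rψ t₀ t₁ (neronUnit e₁ N xP) hψdom hψint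
    (fun t ht => (hfib t ht).2.1)
  obtain ⟨hDval, hDintg⟩ := value_logBox_eq RD t₀ t₁ (tangentDatum e₁) hDdom hDint
    (fun t ht => (hfib t ht).1)
  -- (5) integrate the fibre identity over the arc
  rw [hIval', hPval', hψval, hDval, ← integral_const_mul (4 * (N : ℝ) ^ 2),
    ← integral_const_mul (((N : ℝ) - 2 * a) ^ 2),
    ← integral_add (hIint'.const_mul _) (hPint'.const_mul _), ← integral_const_mul ((N : ℝ) - 2),
    ← integral_const_mul (4 * (N : ℝ)), ← integral_const_mul ((N : ℝ) ^ 2 * ((N : ℝ) - 2)),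
    ← integral_sub (hψintg.const_mul _) (hDintg.const_mul _)]
  exact setIntegral_congr_fun measurableSet_Ioo fun t ht => (hfib t ht).2.2

/-! ### F4: Conjecture 1 ⇒ the rung (UNCONDITIONAL) -/

theorem neronTorsionArcs_iff : NeronTorsionArcs ↔ NeronTorsionPrimitiveChain ∧ NeronTorsionArcChain := by
  constructor
  · intro h; exact ⟨h false, h true⟩
  · rintro ⟨h₀, h₁⟩ b; cases b
    · exact h₀
    · exact h₁

/-- The floor, with conclusion literally `NeronTorsionPrimitiveChain` (an `aesop` rule: `aesop` normalises the goal
`NeronTorsionArcs` to its two members before applying rules). -/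
@[aesop safe apply]
theorem floor_holds : NeronTorsionPrimitiveChain :=
  Summit.KontsevichZagierPeriods.KontsevichZagierPeriods.Cruxes.NeronTorsionSector.Translation.stub_assembly

/-- Member `false` is the CLOSED floor (seed `stub_assembly`, by name). -/
@[aesop safe apply]
theorem rung_false : NeronTorsionArcMember false :=
  Summit.KontsevichZagierPeriods.KontsevichZagierPeriods.Cruxes.NeronTorsionSector.Translation.stub_assembly

/-- **Conjecture 1 ⇒ member `true`**: the kernel form of Conjecture 1 (`kzKernelConjecture_iff_isRational`)
applied to the pinned element; its evaluation vanishes by the value identity. -/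
@[aesop 95% apply]
theorem neronTorsionArcChain_of_kontsevichZagierPeriods (h : _root_.KontsevichZagierPeriods) :
    NeronTorsionArcChain := by
  have hK : KZKernelConjecture := kzKernelConjecture_iff_isRational.mpr h
  intro e₁ t₀ t₁ N a xP hdata RI RP Rψ RD hreps hψdom hψint hDdom hDint
  apply hK
  have hv := arcValueIdentity e₁ t₀ t₁ N a xP hdata RI RP Rψ RD hreps hψdom hψint hDdom hDint
  simp only [map_add, map_sub, map_zsmul, KZ.eval_of, zsmul_eq_mul]
  push_cast
  linear_combination hv

/-- **F4 ON-PATH LEMMA: `KontsevichZagierPeriods → NeronTorsionArcs`** (sorry-free, unconditional).  Tagged as an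
`aesop` apply rule so that the tribunal's cheap forward portfolio (`intro h; aesop`, no library search) finds the
landed lemma: the remaining goal `KontsevichZagierPeriods` is the hypothesis. -/
@[aesop 95% apply]
theorem neronTorsionArcs_of_kontsevichZagierPeriods (h : _root_.KontsevichZagierPeriods) :
    NeronTorsionArcs :=
  neronTorsionArcs_iff.mpr ⟨rung_false, neronTorsionArcChain_of_kontsevichZagierPeriods h⟩

example : _root_.KontsevichZagierPeriods → NeronTorsionArcs := neronTorsionArcs_of_kontsevichZagierPeriods

end Summit.KontsevichZagierPeriods.KontsevichZagierPeriods.Cruxes.TorsionSectorComplete.NeronTorsionModularArc.OnPath
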